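import Summits.QuantumFields.YangMills.Theorems.BalabanUVNodesN21LocalAveragedRegularityBoxes
import Summits.QuantumFields.YangMills.Theorems.BalabanLadderUVSeamRecPolymerDataLevelZero
import Literature.MathematicalPhysics.QuantumFieldTheory.Balaban1983to89.B10Eq5RegularAction
import Literature.MathematicalPhysics.QuantumFieldTheory.Balaban1983to89.B10Eq71TorusLocal
import HarnessLib

/-!
# Crux `UVSeamRec` (stmt-QuantumFields-20043), v5(α) stub `stub_responseMomentsOdd6` (RM), lane B: a LEVEL-`k` LARGE FIELD IS CARRIED BY A
# FINE PLAQUETTE — the deterministic transfer DOWN the scales behind the far-UV window cell laws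

Helper file (`--supports stmt-QuantumFields-20043`) of the width-lever seat `ym-20043-ceilings-p2` (lane B, gen 4).  The large-field input that
lane B's (β) architecture still asks for at levels `k ≥ 1` is the WINDOW CELL LAW of `…CeilingsWindowCellLaws` (p554392): on every odd torus the
events `largeFieldEvent 𝔟 ε γ = {η | ε ≤ 1 − reTr Ū^k(∂γ)(η)}` (tempered-d1's `…PolymerData`, Bałaban's `k`-fold (0.4) block average of record read
on the chart torus of the block of `γ`) of a grid-aligned non-wrapping family are multiplicatively rare.  This file proves the DETERMINISTIC half of
its far-ultraviolet instance: a level-`k` large field forces a FINE plaquette excitation of size `≍ b^{−4k}` inside a box of radius `≈ 9b^k` around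
the block (§3), by reading the tree's LOCAL and `k`-uniform Proposition 2 of [Balaban1985Averaging] for the averaging of record
(`N21LocalAveragedRegularity.plaqSmallOn_iter_blockAvg_eml_loc`, Track A node N21) contrapositively on tempered-d1's chart, with SHARP nested
radii `r_i = (8b+2)(b^{k−i} − 1)/(b − 1)` so that for block sizes `b ≥ 11` the regularity boxes never wrap the chart torus (§1), and converting
`dist1` to `1 − reTr` by [Balaban1985UV3] (11) (`one_sub_reTr_le_specialUnitaryGroup`, `dist1_sq_le_specialUnitaryGroup`).  The sequel
`…CeilingsFarUVWindowCellLaws` turns §3 into the window cell law with activity `(min 1 (n_k·δ₀(β, θ_k)))^{1/C}`, `δ₀` the PROVED period-free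
level-`0` activity (p553454).

* §1 arithmetic of the sharp radii and of the chart window (`b = 2a+1 ≥ 11`): `sharpRadius_succ` (the nesting identity `b·r_{i+1} + (8b+2) = r_i`),
  `chartWindow_bounds` (the witness box `[c₀ − r₀, c₀ + r₀ + 1]`, `c₀ = b^k(b−1) + (b^k−1)/2`, lies in `[0, 2b^{k+1} − 2]`).
* §2 `plaqHol_ofConfig_chart_castSite` — a non-wrapping level-`0` plaquette of the chart torus reads the honest `ℤ⁴` plaquette of `η`.
* §3 **`exists_levelZero_witness_of_mem_largeFieldEvent`** — for `b ≥ 11`, `ε > 0`, every level `k`: `η ∈ largeFieldEvent 𝔟 ε (k, y, μ<ν)` ⇒ there is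
  a `ℤ⁴` plaquette `(z; μ′<ν′)` with `|z − (b^k y + (b^k−1)/2)|_∞ ≤ r₀ + 1`, `r₀ = (8b+2)·Σ_{l<k} b^l`, and
  `η ∈ largeFieldEvent 𝔟 θ_k(ε) (0, z, μ′<ν′)`, `θ_k(ε) = min(ε/2, (109824·b²·N)⁻²) / (2N·b^{4k})`.

HONEST FRAMING: a deterministic lemma about Bałaban's block averaging (all inputs BY NAME from the tree's Track A typing); it feeds a FAR-UV rung of the
window cell laws (nontrivial iff `b^{4k} ≲ β/log β`); the characteristic scales `b^k ≍ R` of (RM) need Bałaban's effective-action large-field bounds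
(R-operation) — OPEN; nothing of E0′; not a gap, not Clay.
References: T. Bałaban, Commun. Math. Phys. 98 (1985) 17–51, Prop. 2 (52)–(54) p. 26; 102 (1985) 255–275, (11) p. 258; 109 (1987) 249–301, (0.4) p. 253.
-/

set_option autoImplicit false

noncomputable section

open Literature.MathematicalPhysics.QuantumFieldTheory (GaugeConfig)
open Literature.MathematicalPhysics.QuantumFieldTheory.Balaban1983to89
open Literature.MathematicalPhysics.QuantumLattice (LGConfig plaquetteHolonomyZd)
open Literature.MathematicalPhysics.QuantumFieldTheory.Balaban1983to89.T4AxialGaugeSmallField (castSite castSite_apply boxPlaqs castSite_add_e)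
open Literature.MathematicalPhysics.QuantumFieldTheory.Balaban1983to89.B7Prop1Explicit (e e_apply)
open Literature.MathematicalPhysics.QuantumFieldTheory.Balaban1983to89.ExpMeanLog (deltaSU expMeanLogSU)
open Literature.MathematicalPhysics.QuantumFieldTheory.Balaban1983to89.B10Eq5RegularAction (one_sub_reTr_le_specialUnitaryGroup)
open Literature.MathematicalPhysics.QuantumFieldTheory.Balaban1983to89.B10Eq71TorusLocal (dist1_sq_le_specialUnitaryGroup)
open Summit.QuantumFields.YangMills.BalabanUVNodes.N20LCSAvgDominationRegion (boxRegion mem_boxRegion)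
open Summit.QuantumFields.YangMills.Theorems.N21LocalAveragedRegularity (plaqSmallOn_iter_blockAvg_eml_loc boxRegion_subset_boxPlaqs
  castSite_centre_chain castSite_centre_top)

namespace Summit.QuantumFields.YangMills.Cruxes.UVSeamRec.PolymerRarity

open Summit.QuantumFields.YangMills.Cruxes.UVSeamRec.PolymerData

/-! ## §1 Arithmetic: the sharp nested radii and the chart window -/

section Arithmetic

/-- **THE NESTING IDENTITY OF THE SHARP RADII** `r_i = (8b+2)·Σ_{l<k−i} b^l`: `b·r_{i+1} + (8b+2) = r_i` for `i < k` — the hypothesis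
`L·r(i+1) + ((d+4)L + 2) ≤ r(i)` of `N21LocalAveragedRegularity.plaqSmallOn_iter_blockAvg_eml_loc` (`d = 4`, `L = b`) with EQUALITY, so that the
total fine radius is `(8b+2)(b^k − 1)/(b−1) < 9b^k` (`b ≥ 11`) instead of the closed form `b^k(8b+2)` of `nested_radii_pow`. [folklore] -/
theorem sharpRadius_succ (b k i : ℕ) (hi : i < k) :
    b * ((8 * b + 2) * ∑ l ∈ Finset.range (k - (i + 1)), b ^ l) + (8 * b + 2) =
      (8 * b + 2) * ∑ l ∈ Finset.range (k - i), b ^ l := by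
  have hki : k - i = (k - (i + 1)) + 1 := by omega
  have key : ∀ m : ℕ, ∑ l ∈ Finset.range (m + 1), b ^ l = b * ∑ l ∈ Finset.range m, b ^ l + 1 := by
    intro m
    rw [Finset.sum_range_succ', pow_zero, Finset.mul_sum]
    exact congrArg (· + 1) (Finset.sum_congr rfl fun l _ => by ring)
  rw [hki, key]
  ring

/-- The geometric sum in `ℤ`: `(b − 1)·Σ_{l<k} b^l + 1 = b^k`. [folklore] -/
theorem geomSum_intCast (b k : ℕ) :
    ((b : ℤ) - 1) * ((∑ l ∈ Finset.range k, b ^ l : ℕ) : ℤ) + 1 = (b : ℤ) ^ k := by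
  have h := geom_sum_mul (b : ℤ) k
  push_cast
  linear_combination h

/-- **THE CHART WINDOW BOUNDS** (`b` odd, `b ≥ 11`): with `c₀ = b^k(b−1) + (b^k−1)/2` the fine centre of the block tower below the central `k`-site of
tempered-d1's chart and `r₀ = (8b+2)·Σ_{l<k} b^l` the sharp total radius, the witness box `[c₀ − r₀, c₀ + r₀ + 1]` satisfies `0 ≤ c₀ − r₀` and
`c₀ + r₀ + 2 ≤ 2b^{k+1}` — so none of its plaquettes wraps the chart torus `T^{(0)}` (`2b^{k+1}` sites per direction). [folklore] -/
theorem chartWindow_bounds (𝔟 : BlockSize) (hb : 11 ≤ 𝔟.b) (k : ℕ) :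
    (((8 * 𝔟.b + 2) * ∑ l ∈ Finset.range k, 𝔟.b ^ l : ℕ) : ℤ) ≤
        (𝔟.b : ℤ) ^ k * ((𝔟.b : ℤ) - 1) + (((𝔟.b ^ k - 1) / 2 : ℕ) : ℤ) ∧
      (𝔟.b : ℤ) ^ k * ((𝔟.b : ℤ) - 1) + (((𝔟.b ^ k - 1) / 2 : ℕ) : ℤ) +
          (((8 * 𝔟.b + 2) * ∑ l ∈ Finset.range k, 𝔟.b ^ l : ℕ) : ℤ) + 2 ≤ 2 * (𝔟.b : ℤ) ^ (k + 1) := by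
  obtain ⟨a, ha⟩ : Odd 𝔟.b := 𝔟.hb.1
  obtain ⟨t, ht⟩ : Odd (𝔟.b ^ k) := 𝔟.hb.1.pow
  have ha5 : (5 : ℤ) ≤ a := by have : 11 ≤ 2 * a + 1 := ha ▸ hb; omega
  have htq : (𝔟.b ^ k - 1) / 2 = t := by omega
  rw [htq]
  set S : ℤ := ((∑ l ∈ Finset.range k, 𝔟.b ^ l : ℕ) : ℤ) with hSdef
  have hS0 : 0 ≤ S := by rw [hSdef]; positivity
  have hgeom : ((𝔟.b : ℤ) - 1) * S + 1 = (𝔟.b : ℤ) ^ k := geomSum_intCast 𝔟.b k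
  have hbz : (𝔟.b : ℤ) = 2 * a + 1 := by exact_mod_cast ha
  have htz : ((𝔟.b : ℤ)) ^ k = 2 * (t : ℤ) + 1 := by exact_mod_cast ht
  -- `b^k = 2aS + 1`, `t = aS`
  have hbk : (𝔟.b : ℤ) ^ k = 2 * (a * S) + 1 := by rw [← hgeom, hbz]; ring
  have htS : (t : ℤ) = a * S := by linarith
  have hR : (((8 * 𝔟.b + 2) * ∑ l ∈ Finset.range k, 𝔟.b ^ l : ℕ) : ℤ) = (16 * a + 10) * S := by
    rw [hSdef]; push_cast; rw [hbz]; ring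
  have h1 : 0 ≤ (a - 5) * S := mul_nonneg (by linarith) hS0
  have h2 : 0 ≤ (a - 5) * (a * S) := mul_nonneg (by linarith) (mul_nonneg (by linarith) hS0)
  rw [hR, hbk, htS, pow_succ, hbk, hbz]
  constructor
  · nlinarith
  · nlinarith

end Arithmetic

/-! ## §2 A non-wrapping fine plaquette of the chart torus reads the honest `ℤ⁴` plaquette -/

section ChartReading

variable {G : Type*} [GaugeGroup G]

/-- The canonical representative of an integer label in `[0, M)` is the label itself. [folklore] -/
theorem val_castSite_eq {P : Params} {j : ℕ} (z : Fin P.d → ℤ) (ν : Fin P.d) (h0 : 0 ≤ z ν)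
    (h1 : z ν < (P.sitesPerDir j : ℤ)) : (((castSite z : Site P j) ν).val : ℤ) = z ν := by
  rw [castSite_apply, ZMod.val_intCast, Int.emod_eq_of_lt h0 h1]

/-- **A NON-WRAPPING LEVEL-`0` PLAQUETTE OF THE CHART TORUS READS THE `ℤ⁴` PLAQUETTE OF `η`**: for an integer corner `z` with `0 ≤ z`, `z < M₀`
and `z_μ + 1, z_ν + 1 < M₀` (`M₀ = 2b^{k+1}` sites per direction), the plaquette variable of `ofConfig (chart o η)` at `(castSite z; μ<ν)` is
`plaquetteHolonomyZd η (o + z) μ ν`. [folklore] -/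
theorem plaqHol_ofConfig_chart_castSite (𝔟 : BlockSize) (k : ℕ) (o : Fin 4 → ℤ) (η : LGConfig 4 G) (z : Fin 4 → ℤ) (μ ν : Fin 4)
    (h : μ < ν) (hz0 : ∀ i, 0 ≤ z i) (hz1 : ∀ i, z i < ((chartParams 𝔟 k).sitesPerDir 0 : ℤ))
    (hzμ : z μ + 1 < ((chartParams 𝔟 k).sitesPerDir 0 : ℤ)) (hzν : z ν + 1 < ((chartParams 𝔟 k).sitesPerDir 0 : ℤ)) :
    GaugeField.plaqHol (ofConfig (P := chartParams 𝔟 k) (j := 0) (chart (chartOrigin 𝔟 k o) η))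
        ⟨castSite z, μ, ν, h⟩ = plaquetteHolonomyZd η (chartOrigin 𝔟 k o + z) μ ν := by
  -- the three corners read by the plaquette, as honest integer vectors
  have hsrc : (fun i => chartOrigin 𝔟 k o i + ((((castSite z : Site (chartParams 𝔟 k) 0)) i).val : ℤ)) = chartOrigin 𝔟 k o + z := by
    funext i
    rw [val_castSite_eq (P := chartParams 𝔟 k) (j := 0) z i (hz0 i) (hz1 i), Pi.add_apply]
  have hshift : ∀ κ : Fin 4, z κ + 1 < ((chartParams 𝔟 k).sitesPerDir 0 : ℤ) →
      (fun i => chartOrigin 𝔟 k o i + ((((castSite z : Site (chartParams 𝔟 k) 0).shift κ) i).val : ℤ)) =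
        chartOrigin 𝔟 k o + z + Pi.single κ 1 := by
    intro κ hκ
    rw [← castSite_add_e]
    funext i
    have h0' : 0 ≤ (z + e κ) i := by
      rw [Pi.add_apply, e_apply]; split_ifs <;> linarith [hz0 i]
    have h1' : (z + e κ) i < ((chartParams 𝔟 k).sitesPerDir 0 : ℤ) := by
      rw [Pi.add_apply, e_apply]
      split_ifs with hi
      · subst hi; exact hκ
      · linarith [hz1 i]
    rw [val_castSite_eq (P := chartParams 𝔟 k) (j := 0) (z + e κ) i h0' h1', Pi.add_apply, Pi.add_apply, Pi.add_apply, e_apply, Pi.single_apply]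
    split_ifs <;> ring
  unfold GaugeField.plaqHol plaquetteHolonomyZd
  simp only [ofConfig_apply, chart_apply]
  rw [hsrc, hshift μ hzμ, hshift ν hzν]

end ChartReading

/-! ## §3 A level-`k` large field is carried by a fine plaquette in a box of radius `≈ 9b^k` -/

section Transfer

variable {N : ℕ} [NeZero N]

/-- `δ_N = min(1/3, π/N) ≥ 1/(3N)`. [folklore] -/
theorem one_div_le_deltaSU : 1 / (3 * (N : ℝ)) ≤ deltaSU (Fin N) := by
  have hN : (1 : ℝ) ≤ N := by exact_mod_cast Nat.one_le_iff_ne_zero.mpr (NeZero.ne N)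
  have hN0 : (0 : ℝ) < N := by linarith
  unfold deltaSU
  rw [Fintype.card_fin]
  refine le_min ?_ ?_
  · rw [div_le_div_iff₀ (by positivity) (by norm_num)]; linarith
  · rw [div_le_div_iff₀ (by positivity) hN0]; nlinarith [Real.pi_gt_three]

/-- **A LEVEL-`k` LARGE FIELD IS CARRIED BY A FINE PLAQUETTE** (the deterministic transfer down the scales).  Block size `b ≥ 11` (odd), any `N ≥ 1`,
any level `k`, threshold `ε > 0`: if `η ∈ largeFieldEvent 𝔟 ε (k, y, μ<ν)` — i.e. `ε ≤ 1 − reTr Ū^k(∂p)(η)` for Bałaban's `k`-fold (0.4) average of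
record on the chart of the block `b^k y + [0,b^k)⁴` — then some `ℤ⁴` plaquette `(z; μ′<ν′)` with `|z_i − (b^k y_i + (b^k−1)/2)| ≤ (8b+2)·Σ_{l<k} b^l + 1`
(`< 9b^k`) carries the fine excitation `min(ε/2, (109824·b²·N)⁻²)/(2N·(b^k)⁴) ≤ 1 − reTr η(∂(z; μ′,ν′))`, i.e. `η ∈ largeFieldEvent 𝔟 θ_k(ε) (0, z, μ′<ν′)`.
Proof: `1 − reTr ≤ ½ dist1²` ([Balaban1985UV3] (11)) makes `dist1 Ū^k(∂p) ≥ √(2ε)`; if every fine plaquette of the box were within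
`α₀ b^{−2k}` of `1`, `α₀ = min(√(ε/2), (109824 b² N)⁻¹)` (so `C₀(4)α₀ ≤ ⅓`, `2α₀ ≤ c′₂`), the LOCAL `k`-uniform Prop. 2 of [Balaban1985Averaging] for
the averaging of record (`N21LocalAveragedRegularity.plaqSmallOn_iter_blockAvg_eml_loc`, along the integer chain of block centres
`castSite_centre_chain` with the sharp radii of §1) would give `dist1 Ū^k(∂p) < α₀ + 2C₀α₀² < 2α₀ ≤ √(2ε)`; the witness plaquette does not wrap the
chart torus (§1) and so reads the honest `ℤ⁴` plaquette (§2), and `dist1² ≤ 2N(1 − reTr)` converts back.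
[cite: Balaban1985Averaging, Prop. 2 (52)–(54) p.26] -/
theorem exists_levelZero_witness_of_mem_largeFieldEvent (𝔟 : BlockSize) (hb : 11 ≤ 𝔟.b) {ε : ℝ} (hε : 0 < ε)
    (k : ℕ) (y : Fin 4 → ℤ) (μ ν : Fin 4) (h : μ < ν) (η : LGConfig 4 (Matrix.specialUnitaryGroup (Fin N) ℂ))
    (hη : η ∈ largeFieldEvent (N := N) 𝔟 ε ⟨k, y, μ, ν, h⟩) :
    ∃ (z : Fin 4 → ℤ) (μ' ν' : Fin 4) (h' : μ' < ν'),
      (∀ i, |z i - ((𝔟.b : ℤ) ^ k * y i + (((𝔟.b ^ k - 1) / 2 : ℕ) : ℤ))| ≤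
          (((8 * 𝔟.b + 2) * ∑ l ∈ Finset.range k, 𝔟.b ^ l : ℕ) : ℤ) + 1) ∧
      η ∈ largeFieldEvent (N := N) 𝔟
        (min (ε / 2) ((1 / (109824 * (𝔟.b : ℝ) ^ 2 * N)) ^ 2) / (2 * N * ((𝔟.b : ℝ) ^ k) ^ 4)) ⟨0, z, μ', ν', h'⟩ := by
  classical
  -- notation
  set P : Params := chartParams 𝔟 k with hPdef
  set U : GaugeField P 0 (Matrix.specialUnitaryGroup (Fin N) ℂ) :=
    ofConfig (P := chartParams 𝔟 k) (j := 0) (chart (chartOrigin 𝔟 k y) η) with hUdef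
  set K : ℝ := 1 / (109824 * (𝔟.b : ℝ) ^ 2 * N) with hKdef
  set α₀ : ℝ := min (Real.sqrt (ε / 2)) K with hα₀def
  set R0 : ℕ := (8 * 𝔟.b + 2) * ∑ l ∈ Finset.range k, 𝔟.b ^ l with hR0def
  set t : ℕ := (𝔟.b ^ k - 1) / 2 with htdef
  set C0 : ℤ := (𝔟.b : ℤ) ^ k * ((𝔟.b : ℤ) - 1) + (t : ℤ) with hC0def
  have hb1 : (1 : ℝ) ≤ 𝔟.b := by exact_mod_cast 𝔟.one_le
  have hbpos : (0 : ℝ) < 𝔟.b := by linarith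
  have hN1 : (1 : ℝ) ≤ N := by exact_mod_cast Nat.one_le_iff_ne_zero.mpr (NeZero.ne N)
  have hN0 : (0 : ℝ) < N := by linarith
  have hK0 : 0 < K := by rw [hKdef]; positivity
  have hα0 : 0 < α₀ := lt_min (Real.sqrt_pos.2 (by linarith)) hK0
  have hαK : α₀ ≤ K := min_le_right _ _
  have hαε : α₀ ^ 2 ≤ ε / 2 := by
    have h1 : α₀ ≤ Real.sqrt (ε / 2) := min_le_left _ _
    have h2 : α₀ ^ 2 ≤ Real.sqrt (ε / 2) ^ 2 := pow_le_pow_left₀ hα0.le h1 2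
    rwa [Real.sq_sqrt (by linarith)] at h2
  -- the two smallness constraints of Prop. 2 (`C₀(4) = 143·16² = 36608`, `c′₂ = 2δ_N/(8b)²`)
  have hα3 : (143 * ((((P.d + 4 : ℕ) : ℝ)) ^ 2 / 4) ^ 2) * α₀ ≤ 1 / 3 := by
    show (143 * ((((4 + 4 : ℕ) : ℝ)) ^ 2 / 4) ^ 2) * α₀ ≤ 1 / 3
    have hK1 : K ≤ 1 / 109824 := by
      rw [hKdef, div_le_div_iff₀ (by positivity) (by norm_num)]
      nlinarith [mul_le_mul hb1 hb1 zero_le_one hbpos.le]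
    norm_num
    linarith
  have hα2 : 2 * α₀ ≤ 2 * deltaSU (Fin N) / (((P.d + 4) * P.L : ℕ) : ℝ) ^ 2 := by
    show 2 * α₀ ≤ 2 * deltaSU (Fin N) / (((4 + 4) * 𝔟.b : ℕ) : ℝ) ^ 2
    have hδ := one_div_le_deltaSU (N := N)
    have h64 : (0 : ℝ) < (((4 + 4) * 𝔟.b : ℕ) : ℝ) ^ 2 := by positivity
    rw [le_div_iff₀ h64]
    push_cast
    have hK2 : K * (64 * (𝔟.b : ℝ) ^ 2) ≤ 1 / (3 * (N : ℝ)) := by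
      rw [hKdef, div_mul_eq_mul_div, one_mul, div_le_div_iff₀ (by positivity) (by positivity)]
      nlinarith [hbpos]
    nlinarith [hαK, hbpos]
  -- Step 1: the block field large ⇒ `dist1 Ū^k(∂p) ≥ √(2ε)`, squared
  have hg : 2 * ε ≤ dist1 (GaugeField.plaqHol (blockAvgIter (N := N) 𝔟 k U) (centralPlaq 𝔟 k μ ν h)) ^ 2 := by
    have h1 : ε ≤ 1 - reTr (GaugeField.plaqHol (blockAvgIter (N := N) 𝔟 k U) (centralPlaq 𝔟 k μ ν h)) := hη
    have h2 := one_sub_reTr_le_specialUnitaryGroup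
      (GaugeField.plaqHol (blockAvgIter (N := N) 𝔟 k U) (centralPlaq 𝔟 k μ ν h))
    linarith
  -- the integer chain of block centres below the central `k`-site `(b−1)·𝟙`
  set c : Fin 4 → ℤ := fun _ => (𝔟.b : ℤ) - 1 with hcdef
  set xs : (i : ℕ) → Site P i :=
    fun i => castSite (fun ν => (P.L : ℤ) ^ (k - i) * c ν + (((P.L ^ (k - i) - 1) / 2 : ℕ) : ℤ)) with hxs_def
  have hxs : ∀ i < k, xs i = emb (xs (i + 1)) := fun i hi => castSite_centre_chain (P := P) k c i hi
  have hxk : xs k = castSite c := castSite_centre_top (P := P) k c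
  have hx0 : xs 0 = castSite (fun _ => C0) := by
    simp only [hxs_def, Nat.sub_zero, hC0def, htdef, hcdef]
    rfl
  -- the sharp radii
  set r : ℕ → ℕ := fun i => (8 * 𝔟.b + 2) * ∑ l ∈ Finset.range (k - i), 𝔟.b ^ l with hrdef
  have hr : ∀ i < k, P.L * r (i + 1) + ((P.d + 4) * P.L + 2) ≤ r i := by
    intro i hi
    show 𝔟.b * ((8 * 𝔟.b + 2) * ∑ l ∈ Finset.range (k - (i + 1)), 𝔟.b ^ l) + ((4 + 4) * 𝔟.b + 2) ≤
      (8 * 𝔟.b + 2) * ∑ l ∈ Finset.range (k - i), 𝔟.b ^ l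
    rw [show (4 + 4) * 𝔟.b + 2 = 8 * 𝔟.b + 2 by ring, sharpRadius_succ 𝔟.b k i hi]
  have hrk : r k = 0 := by simp [hrdef]
  have hr0 : r 0 = R0 := by simp [hrdef, hR0def]
  -- the central plaquette lies in the radius-0 box around `xs k`
  have hcentral : centralPlaq 𝔟 k μ ν h ∈ boxRegion (xs k) (r k) := by
    rw [hxk, hrk]
    refine mem_boxRegion.mpr fun ν' => ⟨0, le_rfl, ?_⟩
    show (((𝔟.b - 1 : ℕ) : ZMod (P.sitesPerDir k))) = (castSite c : Site P k) ν' + ((0 : ℤ) : ZMod (P.sitesPerDir k))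
    rw [castSite_apply, hcdef]
    push_cast [Nat.cast_sub 𝔟.one_le]
    ring
  -- Step 2: some fine plaquette of the witness box is NOT within `α₀ b^{−2k}` of `1`
  obtain ⟨q, hqbox, hqbig⟩ : ∃ q ∈ (boxPlaqs (fun _ => C0 - (R0 : ℤ)) (fun _ => C0 + (R0 : ℤ) + 1) : Set (Plaq P 0)),
      α₀ * (((𝔟.b : ℝ) ^ k)⁻¹) ^ 2 ≤ dist1 (GaugeField.plaqHol U q) := by
    by_contra hcon
    push Not at hcon
    have h52 : PlaqSmallOn (↑(boxRegion (xs 0) (r 0)) : Set (Plaq P 0)) (α₀ * (((P.L : ℝ) ^ k)⁻¹) ^ 2) U := by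
      intro q hq
      rw [hx0, hr0] at hq
      exact hcon q (boxRegion_subset_boxPlaqs (fun _ => C0) R0 hq)
    have hmain := plaqSmallOn_iter_blockAvg_eml_loc (n := Fin N) k hα0 hα3 hα2 xs hxs r hr h52
    have hlt : dist1 (GaugeField.plaqHol (blockAvgIter (N := N) 𝔟 k U) (centralPlaq 𝔟 k μ ν h)) <
        α₀ + 2 * (143 * ((((P.d + 4 : ℕ) : ℝ)) ^ 2 / 4) ^ 2) * α₀ ^ 2 :=
      hmain _ (Finset.mem_coe.mpr hcentral)
    -- `α₀ + 2C₀α₀² ≤ α₀ + (2/3)α₀ < 2α₀`, and `(2α₀)² ≤ 2ε`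
    have hC : 2 * (143 * ((((P.d + 4 : ℕ) : ℝ)) ^ 2 / 4) ^ 2) * α₀ ^ 2 ≤ 2 / 3 * α₀ := by
      have := mul_le_mul_of_nonneg_right hα3 hα0.le
      nlinarith
    have hd0 : 0 ≤ dist1 (GaugeField.plaqHol (blockAvgIter (N := N) 𝔟 k U) (centralPlaq 𝔟 k μ ν h)) :=
      GaugeGroup.dist1_nonneg _
    have hlt2 : dist1 (GaugeField.plaqHol (blockAvgIter (N := N) 𝔟 k U) (centralPlaq 𝔟 k μ ν h)) < 2 * α₀ := by linarith
    have hsq : dist1 (GaugeField.plaqHol (blockAvgIter (N := N) 𝔟 k U) (centralPlaq 𝔟 k μ ν h)) ^ 2 < (2 * α₀) ^ 2 :=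
      pow_lt_pow_left₀ hlt2 hd0 two_ne_zero
    nlinarith
  -- Step 3: the witness plaquette, as an honest `ℤ⁴` plaquette of `η`
  obtain ⟨zq, hlo, hhi, hsrc⟩ := hqbox
  obtain ⟨hW1, hW2⟩ := chartWindow_bounds 𝔟 hb k
  have hM : ((P.sitesPerDir 0 : ℕ) : ℤ) = 2 * (𝔟.b : ℤ) ^ (k + 1) := by
    rw [hPdef, chartParams_sitesPerDir, show 1 + k - 0 = k + 1 by omega]; push_cast; ring
  have hz0 : ∀ i, 0 ≤ zq i := fun i => by
    have := hlo i
    simp only at this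
    linarith
  have hzle : ∀ i, zq i ≤ C0 + R0 + 1 := fun i => by
    have h1 := hhi i
    simp only [Pi.add_apply, e_apply] at h1
    split_ifs at h1 <;> linarith
  have hz1 : ∀ i, zq i < ((P.sitesPerDir 0 : ℕ) : ℤ) := fun i => by rw [hM]; linarith [hzle i]
  have hzdir : ∀ κ, (κ = q.μ ∨ κ = q.ν) → zq κ + 1 < ((P.sitesPerDir 0 : ℕ) : ℤ) := by
    intro κ hκ
    have h1 := hhi κ
    have hμν : q.μ ≠ q.ν := q.hμν.ne
    simp only [Pi.add_apply, e_apply] at h1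
    rw [hM]
    rcases hκ with rfl | rfl
    · rw [if_pos rfl] at h1; split_ifs at h1 <;> linarith
    · rw [if_pos rfl, if_neg hμν.symm] at h1; linarith
  obtain ⟨src, μ', ν', h'⟩ := q
  simp only at hsrc hzdir hqbig
  subst hsrc
  have hread := plaqHol_ofConfig_chart_castSite 𝔟 k y η zq μ' ν' h' hz0 hz1 (hzdir μ' (Or.inl rfl)) (hzdir ν' (Or.inr rfl))
  refine ⟨chartOrigin 𝔟 k y + zq, μ', ν', h', fun i => ?_, ?_⟩
  · -- the box bound: `z − (b^k y + t) = zq − C0`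
    have e1 : (chartOrigin 𝔟 k y + zq) i - ((𝔟.b : ℤ) ^ k * y i + (t : ℤ)) = zq i - C0 := by
      rw [Pi.add_apply, chartOrigin, hC0def]; ring
    rw [e1, abs_le]
    have := hlo i
    simp only at this
    constructor <;> linarith [hzle i]
  · -- the fine excitation in the `1 − reTr` currency
    rw [mem_largeFieldEvent_zero_iff, ← hread]
    have hW := dist1_sq_le_specialUnitaryGroup (N := N) (GaugeField.plaqHol U ⟨castSite zq, μ', ν', h'⟩)
    have hbk : (0 : ℝ) < ((𝔟.b : ℝ) ^ k) := by positivity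
    have hα0' : 0 ≤ α₀ * (((𝔟.b : ℝ) ^ k)⁻¹) ^ 2 := by positivity
    have hsq : (α₀ * (((𝔟.b : ℝ) ^ k)⁻¹) ^ 2) ^ 2 ≤ dist1 (GaugeField.plaqHol U ⟨castSite zq, μ', ν', h'⟩) ^ 2 :=
      pow_le_pow_left₀ hα0' hqbig 2
    have hmin : min (ε / 2) (K ^ 2) ≤ α₀ ^ 2 := by
      rcases le_total (Real.sqrt (ε / 2)) K with hle | hle
      · have : α₀ = Real.sqrt (ε / 2) := min_eq_left hle
        rw [this, Real.sq_sqrt (by linarith)]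
        exact min_le_left _ _
      · have : α₀ = K := min_eq_right hle
        rw [this]
        exact min_le_right _ _
    rw [div_le_iff₀ (by positivity)]
    have e2 : (α₀ * (((𝔟.b : ℝ) ^ k)⁻¹) ^ 2) ^ 2 * ((𝔟.b : ℝ) ^ k) ^ 4 = α₀ ^ 2 := by
      field_simp
    have hb4 : (0 : ℝ) ≤ ((𝔟.b : ℝ) ^ k) ^ 4 := by positivity
    calc min (ε / 2) (K ^ 2) ≤ α₀ ^ 2 := hmin
      _ = (α₀ * (((𝔟.b : ℝ) ^ k)⁻¹) ^ 2) ^ 2 * ((𝔟.b : ℝ) ^ k) ^ 4 := e2.symm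
      _ ≤ dist1 (GaugeField.plaqHol U ⟨castSite zq, μ', ν', h'⟩) ^ 2 * ((𝔟.b : ℝ) ^ k) ^ 4 :=
          mul_le_mul_of_nonneg_right hsq hb4
      _ ≤ 2 * ((N : ℝ) * (1 - reTr (GaugeField.plaqHol U ⟨castSite zq, μ', ν', h'⟩))) * ((𝔟.b : ℝ) ^ k) ^ 4 :=
          mul_le_mul_of_nonneg_right hW hb4
      _ = (1 - reTr (GaugeField.plaqHol U ⟨castSite zq, μ', ν', h'⟩)) * (2 * N * ((𝔟.b : ℝ) ^ k) ^ 4) := by ring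

end Transfer

end Summit.QuantumFields.YangMills.Cruxes.UVSeamRec.PolymerRarity

end
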